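import Literature.AlgebraicGeometry.Motives.StandardConjectureCFactorsOfProducts
import Literature.AlgebraicGeometry.Motives.KunnethComponentsOfAlgebraicClasses
import HarnessLib

/-!
# The edge Künneth components of an algebraic class are algebraic, unconditionally
(Kleiman 1968 §1.3; Kahn 2020 §3.5.1 and Thm. 6.31 (1))

Let `W` be a Weil cohomology theory, `X`, `Z` smooth projective of dimensions `n`, `m`, and
`z ∈ Hᵈ(X × Z)`. The tree's `KunnethComponentsOfAlgebraicClasses` shows that the Künneth component
of bidegree `(a, b)` of an *algebraic* `z` is algebraic *provided the Künneth projectors `πᵃ_X`,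
`πᵇ_Z` are algebraic*. For the four **edge** bidegrees `(0, d)`, `(2n, d - 2n)`, `(d, 0)`,
`(d - 2m, 2m)` no such hypothesis is needed: with a rational algebraic zero-cycle class
`a ∈ Aⁿ(X)_ℚ` of degree `tr_X a = 1` (`exists_mem_ratAlgebraicClasses_trace_eq_one`) the components
are given by the explicit formulas

* `z_{0,d} = pr_Z^* pr_{Z*} (pr_X^* a ∪ z)` (`extTensor_kunnethComponent_zero_eq`),
* `z_{2n,d-2n} = a × pr_{Z*} z` (`extTensor_kunnethComponent_top_eq`),

and symmetrically for `(d, 0)`, `(d - 2m, 2m)` with `b ∈ Aᵐ(Z)_ℚ`, `tr_Z b = 1`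
(`extTensor_kunnethComponent_zero_right_eq`, `extTensor_kunnethComponent_top_right_eq`) — proved by
Künneth induction from the transfer formulas `pr_{Z*} (x × w) = tr_X(x) · w` for `x ∈ H²ⁿ(X)`
(`pushforward_snd_externalCup`) and `= 0` for `x` of lower degree
(`pushforward_snd_externalCup_eq_zero`), i.e. the projection formula and base change of Kahn 2020
§3.5.1 (this lane's `PushforwardProjectionFormula`, `StandardConjectureCFactorsOfProducts`). Since
push-forward, pull-back and cup product preserve rational algebraic classes (Kleiman 1968 §1.3;
the tree's `pushforward_mem_ratAlgebraicClasses`, axioms `pullback_ratAlgebraicClasses_le`,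
`cup_mem_ratAlgebraicClasses`), **the edge Künneth components of a rational algebraic class are
rational algebraic for every `W` and all `X`, `Z`** (`extTensor_kunnethComponent_zero_mem_ratAlgebraicClasses'`,
`…_top_mem_…`, `…_zero_right_mem_…`, `…_top_right_mem_…`). (Kahn 2020 Thm. 6.31 (1) is the case
`Z = X`, `z = Δ`: `π⁰ = (1/deg) [x × X]`, `π²ⁿ = (1/deg) [X × x]`.)

Theorems only; no new definitions, no named facts.

## References

* [Kahn2020] B. Kahn, *Zeta and L-functions of varieties and motives*, LMS Lecture Note Series 462
  (2020), §3.5.1 (projection formula, `Tr = p_*`), §6.9 Thm. 6.31 (1) (proof).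
* [Kleiman1968AlgebraicCycles] S. Kleiman, *Algebraic cycles and the Weil conjectures*, in: Dix
  exposés sur la cohomologie des schémas (1968), §1.2 (B), §1.3.
-/

universe u v

open CategoryTheory AlgebraicGeometry MonoidalCategory CartesianMonoidalCategory
open scoped TensorProduct

noncomputable section

namespace Literature.AlgebraicGeometry.Motives

namespace WeilCohomology

variable {k : Type u} [Field k] {K : Type v} [Field K] [CharZero K] (W : WeilCohomology k K)
variable {n m : ℕ} {X Z : SchemeOver k}

/-! ## One-dimensional top and bottom cohomology -/

/-- `H²ⁿ(X) = K · a` for any class `a` of trace `1`: `x = tr_X(x) · a` (the trace is an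
isomorphism, axiom (A)). [cite: Kleiman1968AlgebraicCycles, §1.2 (A)] -/
theorem eq_trace_smul_of_trace_eq_one (hX : IsSmoothProjective n X) {a : W.obj X (2 * n)}
    (ha : W.trace X n a = 1) (x : W.obj X (2 * n)) : x = W.trace X n x • a :=
  (W.bijective_trace hX).1 (by rw [map_smul, ha, smul_eq_mul, mul_one])

/-! ## Transfer along the second projection -/

/-- `(x × w) ∪ pr_Z^* y = x × (w ∪ y)` on `X × Z` (`cup_assoc`, `map_cup`). Degrees: `|x| = i`,
`|w| = j`, `|y| = l`, `i + j = e`, `j + l = jl`, `e + l = N`, `i + jl = N`. [cite: Kleiman1968AlgebraicCycles, §1.2] -/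
theorem externalCup_cup_snd (hX : IsSmoothProjective n X) (hZ : IsSmoothProjective m Z)
    {i j l e jl N : ℕ} (he : i + j = e) (hjl : j + l = jl) (h₁ : e + l = N) (h₂ : i + jl = N)
    (x : W.obj X i) (w : W.obj Z j) (y : W.obj Z l) :
    W.cup h₁ (W.externalCup X Z he x w) (W.pullback (snd X Z) l y) =
      W.externalCup X Z h₂ x (W.cup hjl w y) := by
  have hXZ := IsSmoothProjective.tensor_holds hX hZ
  rw [W.externalCup_apply, W.externalCup_apply, W.cup_assoc hXZ he hjl h₁ h₂,
    ← W.map_cup hXZ hZ (snd X Z) hjl]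

/-- **Base change**: `pr_{Z*} (pr_X^* a) = tr_X(a) · 1_Z` for `a ∈ H²ⁿ(X)` (pair with
`ω ∈ H^{2m}(Z)`: `tr_Z (pr_{Z*} pr_X^* a ∪ ω) = tr_{X×Z} (pr_X^* a ∪ pr_Z^* ω) = tr_X a · tr_Z ω`,
axiom (B); Kahn 2020 §3.5.1, `Tr = p_*`). [cite: Kahn2020, §3.5.1] [cite: Kleiman1968AlgebraicCycles, §1.2 (B)] -/
theorem pushforward_snd_pullback_fst (hX : IsSmoothProjective n X) (hZ : IsSmoothProjective m Z)
    (a : W.obj X (2 * n)) (he : 2 * n + 2 * m = 2 * (n + m)) (hd : 0 + 2 * m = 2 * m) :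
    W.pushforward (N := n + m) hZ (snd X Z) he hd (W.pullback (fst X Z) (2 * n) a) =
      W.trace X n a • W.one Z := by
  refine (W.pdEquiv hZ hd).injective (LinearMap.ext fun ω ↦ ?_)
  rw [W.pdEquiv_apply, W.pdEquiv_apply, W.trace_cup_pushforward, LinearMap.map_smul₂, map_smul,
    W.one_cup hZ hd, smul_eq_mul, ← W.externalCup_apply, W.trace_externalCup' hX hZ]

/-- **Transfer along `pr_Z`**: `pr_{Z*} (a × w) = tr_X(a) · w` for `a ∈ H²ⁿ(X)`, `w ∈ Hʲ(Z)`
(projection formula `pr_{Z*} (pr_X^* a ∪ pr_Z^* w) = pr_{Z*} pr_X^* a ∪ w`, Kahn 2020 §3.5.1, and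
base change). Degrees: `j + j' = 2m`, `2n + j + j' = 2(n + m)`. [cite: Kahn2020, §3.5.1 (projection formula)] -/
theorem pushforward_snd_externalCup (hX : IsSmoothProjective n X) (hZ : IsSmoothProjective m Z)
    (a : W.obj X (2 * n)) {j j' : ℕ} (hj : j + j' = 2 * m) (w : W.obj Z j)
    (he : 2 * n + j + j' = 2 * (n + m)) :
    W.pushforward (N := n + m) hZ (snd X Z) he hj (W.externalCup X Z rfl a w) =
      W.trace X n a • w := by
  have hXZ := IsSmoothProjective.tensor_holds hX hZ
  rw [W.externalCup_apply,
    W.pushforward_cup_pullback hXZ hZ (snd X Z) rfl he hj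
      (show 2 * n + 2 * m = 2 * (n + m) by omega) (Nat.zero_add _) (Nat.zero_add j)
      (W.pullback (fst X Z) (2 * n) a) w,
    W.pushforward_snd_pullback_fst hX hZ a, LinearMap.map_smul₂, W.one_cup hZ (Nat.zero_add j)]

/-- `pr_{Z*} (x × w) = 0` for `x ∈ Hⁱ(X)` with `i ≠ 2n` (pair with `y`: `tr_{X×Z} ((x × w) ∪ pr_Z^* y)
= tr_{X×Z} (x × (w ∪ y)) = 0` off the top bidegree, axioms (A), (B)). Degrees: `i + j = e`,
`d + d' = 2m`, `e + d' = 2(n + m)`. [cite: Kleiman1968AlgebraicCycles, §1.2 (A)–(B)] -/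
theorem pushforward_snd_externalCup_eq_zero (hX : IsSmoothProjective n X)
    (hZ : IsSmoothProjective m Z) {i j e d d' : ℕ} (hij : i + j = e) (hi : i ≠ 2 * n)
    (hd : d + d' = 2 * m) (he : e + d' = 2 * (n + m)) (x : W.obj X i) (w : W.obj Z j) :
    W.pushforward (N := n + m) hZ (snd X Z) he hd (W.externalCup X Z hij x w) = 0 := by
  refine (W.pdEquiv hZ hd).injective (LinearMap.ext fun y ↦ ?_)
  rw [W.pdEquiv_apply, W.pdEquiv_apply, W.trace_cup_pushforward, map_zero, LinearMap.zero_apply,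
    map_zero, W.externalCup_cup_snd hX hZ hij rfl he (by omega) x w y,
    W.trace_externalCup_eq_zero hX hZ _ hi]

/-- `pr_{X*} (x × w) = 0` for `w ∈ Hʲ(Z)` with `j ≠ 2m` (symmetric to
`pushforward_snd_externalCup_eq_zero`; `(x × w) ∪ pr_X^* y = ± (x ∪ y) × w`). Degrees: `i + j = e`,
`d + d' = 2n`, `e + d' = 2(n + m)`. [cite: Kleiman1968AlgebraicCycles, §1.2 (A)–(B)] -/
theorem pushforward_fst_externalCup_eq_zero (hX : IsSmoothProjective n X)
    (hZ : IsSmoothProjective m Z) {i j e d d' : ℕ} (hij : i + j = e) (hjm : j ≠ 2 * m)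
    (hd : d + d' = 2 * n) (he : e + d' = 2 * (n + m)) (x : W.obj X i) (w : W.obj Z j) :
    W.pushforward (N := n + m) hX (fst X Z) he hd (W.externalCup X Z hij x w) = 0 := by
  refine (W.pdEquiv hX hd).injective (LinearMap.ext fun y ↦ ?_)
  rw [W.pdEquiv_apply, W.pdEquiv_apply, W.trace_cup_pushforward, map_zero, LinearMap.zero_apply,
    map_zero, ← W.externalCup_one_right hX hZ (Nat.add_zero d') y,
    W.cup_externalCup_externalCup hX hZ hij (Nat.add_zero d') he rfl (Nat.add_zero j)
      (show i + d' + j = 2 * (n + m) by omega) x w y (W.one Z),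
    map_zsmul, W.trace_externalCup_eq_zero hX hZ _ (by omega), smul_zero]

/-! ## The edge Künneth components: explicit formulas -/

/-- **The `(0, d)` Künneth component**: for `z ∈ Hᵈ(X × Z)` and `a ∈ H²ⁿ(X)` with `tr_X a = 1`,
`z_{0,d} = pr_Z^* pr_{Z*} (pr_X^* a ∪ z)` (re-embedded in `Hᵈ(X × Z)`). By Künneth induction: on
`x × w` with `x ∈ H⁰(X) = K · 1` both sides are `x × w` (`pr_X^* a ∪ (c 1 × w) = c (a × w)`,
`pr_{Z*} (a × w) = w`), and for `x` of positive degree both vanish (`a ∪ x = 0` above the top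
degree). Degrees: `d + d' = 2m`, `2n + d + d' = 2(n + m)`. (Kahn 2020 Thm. 6.31 (1), proof: the
projector `p⁰` is given by `(1/deg) [x × X]`; here relative to `Z`.)
[cite: Kahn2020, §6.9 Thm. 6.31 (1) (proof)] [cite: Kleiman1968AlgebraicCycles, §1.3] -/
theorem extTensor_kunnethComponent_zero_eq (hX : IsSmoothProjective n X) (hZ : IsSmoothProjective m Z)
    {a : W.obj X (2 * n)} (ha : W.trace X n a = 1) {d d' e : ℕ} (hd : d + d' = 2 * m)
    (hce : 2 * n + d = e) (he : e + d' = 2 * (n + m)) (z : W.obj (X ⊗ Z) d) :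
    W.extTensor (Nat.zero_add d) (W.kunnethComponent hX hZ 0 d (Nat.zero_add d) z) =
      W.pullback (snd X Z) d (W.pushforward (N := n + m) hZ (snd X Z) he hd
        (W.cup hce (W.pullback (fst X Z) (2 * n) a) z)) := by
  have hXZ := IsSmoothProjective.tensor_holds hX hZ
  subst hce
  induction z using W.kunneth_induction hX hZ with
  | zero => simp only [map_zero]
  | add w w' hw hw' => simp only [map_add, hw, hw']
  | ext i j hij x w =>
    by_cases hi : i = 0
    · subst hi
      obtain rfl : j = d := by omega
      obtain ⟨c, rfl⟩ := W.exists_eq_smul_one hX x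
      rw [W.cup_fst_externalCup hX hZ hij rfl (Nat.add_zero (2 * n)) (by omega) a (c • W.one X) w,
        (W.cup (Nat.add_zero (2 * n)) a).map_smul c (W.one X), W.cup_one hX (Nat.add_zero (2 * n)) a,
        W.kunnethComponent_externalCup_self hX hZ, W.extTensor_tmul]
      simp only [map_smul, LinearMap.smul_apply]
      rw [W.pushforward_snd_externalCup hX hZ a hd w he, ha, one_smul, W.externalCup_one_left hX hZ]
    · have hne : ((0 : ℕ), d) ≠ (i, j) := fun h ↦ hi (Prod.mk.inj h).1.symm
      rw [W.kunnethComponent_externalCup_of_ne hX hZ (Nat.zero_add d) hij hne, map_zero,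
        W.cup_fst_externalCup hX hZ hij rfl rfl (by omega) a x w,
        W.eq_zero_of_lt hX (show 2 * n < 2 * n + i by omega) (W.cup rfl a x), LinearMap.map_zero₂,
        map_zero, map_zero]

/-- **The `(2n, j)` Künneth component**: for `z ∈ Hᵈ(X × Z)`, `2n + j = d`, and `a ∈ H²ⁿ(X)` with
`tr_X a = 1`, `z_{2n,j} = a × pr_{Z*} z`. By Künneth induction: on `x × w` with `x ∈ H²ⁿ(X)` both
sides are `x × w` (`x = tr_X(x) · a`, `pr_{Z*} (x × w) = tr_X(x) · w`), and for `x` of other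
degrees both vanish (`pushforward_snd_externalCup_eq_zero`). Degrees: `j + j' = 2m`,
`d + j' = 2(n + m)`. (Kahn 2020 Thm. 6.31 (1), proof: `p²ⁿ` is given by `(1/deg) [X × x]`; here
relative to `Z`.) [cite: Kahn2020, §6.9 Thm. 6.31 (1) (proof)] [cite: Kleiman1968AlgebraicCycles, §1.3] -/
theorem extTensor_kunnethComponent_top_eq (hX : IsSmoothProjective n X) (hZ : IsSmoothProjective m Z)
    {a : W.obj X (2 * n)} (ha : W.trace X n a = 1) {j d j' : ℕ} (h : 2 * n + j = d)
    (hj : j + j' = 2 * m) (he : d + j' = 2 * (n + m)) (z : W.obj (X ⊗ Z) d) :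
    W.extTensor h (W.kunnethComponent hX hZ (2 * n) j h z) =
      W.externalCup X Z h a (W.pushforward (N := n + m) hZ (snd X Z) he hj z) := by
  have hXZ := IsSmoothProjective.tensor_holds hX hZ
  subst h
  induction z using W.kunneth_induction hX hZ with
  | zero => simp only [map_zero]
  | add w w' hw hw' => simp only [map_add, hw, hw']
  | ext i l hil x w =>
    by_cases hi : i = 2 * n
    · subst hi
      obtain rfl : l = j := by omega
      rw [W.kunnethComponent_externalCup_self hX hZ, W.extTensor_tmul,
        W.pushforward_snd_externalCup hX hZ x hj w he, map_smul]
      conv_lhs => rw [W.eq_trace_smul_of_trace_eq_one hX ha x]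
      rw [LinearMap.map_smul₂]
    · have hne : (2 * n, j) ≠ (i, l) := fun h' ↦ hi (Prod.mk.inj h').1.symm
      rw [W.kunnethComponent_externalCup_of_ne hX hZ _ hil hne, map_zero,
        W.pushforward_snd_externalCup_eq_zero hX hZ hil hi hj he x w, map_zero]

/-- **The `(d, 0)` Künneth component**: for `z ∈ Hᵈ(X × Z)` and `b ∈ H^{2m}(Z)` with `tr_Z b = 1`,
`z_{d,0} = pr_X^* pr_{X*} (z ∪ pr_Z^* b)`. Degrees: `d + d' = 2n`, `d + 2m + d' = 2(n + m)`.
[cite: Kahn2020, §6.9 Thm. 6.31 (1) (proof)] [cite: Kleiman1968AlgebraicCycles, §1.3] -/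
theorem extTensor_kunnethComponent_zero_right_eq (hX : IsSmoothProjective n X)
    (hZ : IsSmoothProjective m Z) {b : W.obj Z (2 * m)} (hb : W.trace Z m b = 1) {d d' e : ℕ}
    (hd : d + d' = 2 * n) (hce : d + 2 * m = e) (he : e + d' = 2 * (n + m))
    (z : W.obj (X ⊗ Z) d) :
    W.extTensor (Nat.add_zero d) (W.kunnethComponent hX hZ d 0 (Nat.add_zero d) z) =
      W.pullback (fst X Z) d (W.pushforward (N := n + m) hX (fst X Z) he hd
        (W.cup hce z (W.pullback (snd X Z) (2 * m) b))) := by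
  have hXZ := IsSmoothProjective.tensor_holds hX hZ
  subst hce
  induction z using W.kunneth_induction hX hZ with
  | zero => simp only [map_zero, LinearMap.zero_apply]
  | add w w' hw hw' => simp only [map_add, LinearMap.add_apply, hw, hw']
  | ext i j hij x w =>
    by_cases hj0 : j = 0
    · subst hj0
      obtain rfl : i = d := by omega
      obtain ⟨c, rfl⟩ := W.exists_eq_smul_one hZ w
      rw [W.externalCup_cup_snd hX hZ hij (Nat.zero_add (2 * m)) rfl rfl x (c • W.one Z) b,
        LinearMap.map_smul₂, W.one_cup hZ (Nat.zero_add (2 * m)) b,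
        W.kunnethComponent_externalCup_self hX hZ, W.extTensor_tmul]
      simp only [map_smul]
      rw [W.pushforward_fst_externalCup hX hZ hd x b he, hb, one_smul, W.externalCup_one_right hX hZ]
    · have hne : (d, (0 : ℕ)) ≠ (i, j) := fun h ↦ hj0 (Prod.mk.inj h).2.symm
      rw [W.kunnethComponent_externalCup_of_ne hX hZ (Nat.add_zero d) hij hne, map_zero,
        W.externalCup_cup_snd hX hZ hij rfl rfl (by omega) x w b,
        W.eq_zero_of_lt hZ (show 2 * m < j + 2 * m by omega) (W.cup rfl w b), map_zero, map_zero,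
        map_zero]

/-- **The `(i, 2m)` Künneth component**: for `z ∈ Hᵈ(X × Z)`, `i + 2m = d`, and `b ∈ H^{2m}(Z)`
with `tr_Z b = 1`, `z_{i,2m} = pr_{X*} z × b`. Degrees: `i + i' = 2n`, `d + i' = 2(n + m)`.
[cite: Kahn2020, §6.9 Thm. 6.31 (1) (proof)] [cite: Kleiman1968AlgebraicCycles, §1.3] -/
theorem extTensor_kunnethComponent_top_right_eq (hX : IsSmoothProjective n X)
    (hZ : IsSmoothProjective m Z) {b : W.obj Z (2 * m)} (hb : W.trace Z m b = 1) {i d i' : ℕ}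
    (h : i + 2 * m = d) (hi : i + i' = 2 * n) (he : d + i' = 2 * (n + m)) (z : W.obj (X ⊗ Z) d) :
    W.extTensor h (W.kunnethComponent hX hZ i (2 * m) h z) =
      W.externalCup X Z h (W.pushforward (N := n + m) hX (fst X Z) he hi z) b := by
  have hXZ := IsSmoothProjective.tensor_holds hX hZ
  subst h
  induction z using W.kunneth_induction hX hZ with
  | zero => simp only [map_zero, LinearMap.zero_apply]
  | add w w' hw hw' => simp only [map_add, LinearMap.add_apply, hw, hw']
  | ext i₁ l hil x w =>
    by_cases hl : l = 2 * m
    · subst hl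
      obtain rfl : i₁ = i := by omega
      rw [W.kunnethComponent_externalCup_self hX hZ, W.extTensor_tmul,
        W.pushforward_fst_externalCup hX hZ hi x w he, LinearMap.map_smul₂]
      conv_lhs => rw [W.eq_trace_smul_of_trace_eq_one hZ hb w]
      rw [map_smul]
    · have hne : (i, 2 * m) ≠ (i₁, l) := fun h' ↦ hl (Prod.mk.inj h').2.symm
      rw [W.kunnethComponent_externalCup_of_ne hX hZ _ hil hne, map_zero,
        W.pushforward_fst_externalCup_eq_zero hX hZ hil hl hi he x w, LinearMap.map_zero₂]

/-! ## The edge Künneth components of algebraic classes are algebraic -/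

/-- External products of rational algebraic classes are rational algebraic:
`x ∈ Aᵖ(X)_ℚ`, `w ∈ A^q(Z)_ℚ ⇒ x × w = pr_X^* x ∪ pr_Z^* w ∈ A^{p+q}(X × Z)_ℚ`
(Kleiman 1968 §1.3, `u ⊗ v`; axioms `pullback_ratAlgebraicClasses_le`,
`cup_mem_ratAlgebraicClasses`). [cite: Kleiman1968AlgebraicCycles, §1.3] -/
theorem externalCup_mem_ratAlgebraicClasses (hX : IsSmoothProjective n X)
    (hZ : IsSmoothProjective m Z) {p q c : ℕ} (hpq : p + q = c) (h : 2 * p + 2 * q = 2 * c)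
    {x : W.obj X (2 * p)} (hx : x ∈ W.ratAlgebraicClasses X p) {w : W.obj Z (2 * q)}
    (hw : w ∈ W.ratAlgebraicClasses Z q) :
    W.externalCup X Z h x w ∈ W.ratAlgebraicClasses (X ⊗ Z) c := by
  have hXZ := IsSmoothProjective.tensor_holds hX hZ
  have hx' : W.pullback (fst X Z) (2 * p) x ∈ W.ratAlgebraicClasses (X ⊗ Z) p :=
    W.pullback_ratAlgebraicClasses_le hXZ hX (fst X Z) p ⟨x, hx, rfl⟩
  have hw' : W.pullback (snd X Z) (2 * q) w ∈ W.ratAlgebraicClasses (X ⊗ Z) q :=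
    W.pullback_ratAlgebraicClasses_le hXZ hZ (snd X Z) q ⟨w, hw, rfl⟩
  rw [W.externalCup_apply]
  exact W.cup_mem_ratAlgebraicClasses hXZ hpq _ _ hx' hw'

/-- **The `(0, 2c)` Künneth component of a rational algebraic class is rational algebraic**, for
every Weil cohomology theory and all smooth projective `X`, `Z` (no hypothesis on the Künneth
projectors of `Z`; compare the tree's `extTensor_kunnethComponent_mem_ratAlgebraicClasses`, which
needs `π²ᶜ_Z` algebraic): `z_{0,2c} = pr_Z^* pr_{Z*} (pr_X^* a ∪ z)` with `a ∈ Aⁿ(X)_ℚ`,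
`tr_X a = 1`, and push-forward, pull-back, cup product preserve rational algebraic classes
(Kleiman 1968 §1.3). [cite: Kleiman1968AlgebraicCycles, §1.3] [cite: Kahn2020, §6.9 Thm. 6.31 (1) (proof)] -/
theorem extTensor_kunnethComponent_zero_mem_ratAlgebraicClasses' (hX : IsSmoothProjective n X)
    (hZ : IsSmoothProjective m Z) {c : ℕ} (h : 0 + 2 * c = 2 * c) {z : W.obj (X ⊗ Z) (2 * c)}
    (hz : z ∈ W.ratAlgebraicClasses (X ⊗ Z) c) :
    W.extTensor h (W.kunnethComponent hX hZ 0 (2 * c) h z) ∈ W.ratAlgebraicClasses (X ⊗ Z) c := by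
  have hXZ := IsSmoothProjective.tensor_holds hX hZ
  by_cases hc : c ≤ m
  · obtain ⟨a, ha, htr⟩ := W.exists_mem_ratAlgebraicClasses_trace_eq_one hX
    have ha' : W.pullback (fst X Z) (2 * n) a ∈ W.ratAlgebraicClasses (X ⊗ Z) n :=
      W.pullback_ratAlgebraicClasses_le hXZ hX (fst X Z) n ⟨a, ha, rfl⟩
    have hcup := W.cup_mem_ratAlgebraicClasses hXZ (rfl : n + c = n + c) _ _ ha' hz
    have hpush := W.pushforward_mem_ratAlgebraicClasses hXZ hZ (snd X Z) (a := n + c) (b := c)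
      (d' := 2 * m - 2 * c) (by omega) (by omega) hcup
    rw [W.extTensor_kunnethComponent_zero_eq hX hZ htr (d' := 2 * m - 2 * c) (e := 2 * (n + c))
      (by omega) (by omega) (by omega) z]
    exact W.pullback_ratAlgebraicClasses_le hXZ hZ (snd X Z) c ⟨_, hpush, rfl⟩
  · haveI := W.subsingleton_obj hZ (i := 2 * c) (by omega)
    rw [Subsingleton.elim (W.kunnethComponent hX hZ 0 (2 * c) h z) 0, map_zero]
    exact zero_mem _

/-- **The `(2n, 2c - 2n)` Künneth component of a rational algebraic class is rational algebraic**,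
unconditionally: `z_{2n,2c-2n} = a × pr_{Z*} z` with `a ∈ Aⁿ(X)_ℚ`, `tr_X a = 1`, and
`pr_{Z*} z ∈ A^{c-n}(Z)_ℚ` (`pushforward_mem_ratAlgebraicClasses`). Degrees: `2n + 2q = 2c`.
[cite: Kleiman1968AlgebraicCycles, §1.3] [cite: Kahn2020, §6.9 Thm. 6.31 (1) (proof)] -/
theorem extTensor_kunnethComponent_top_mem_ratAlgebraicClasses' (hX : IsSmoothProjective n X)
    (hZ : IsSmoothProjective m Z) {q c : ℕ} (h : 2 * n + 2 * q = 2 * c) {z : W.obj (X ⊗ Z) (2 * c)}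
    (hz : z ∈ W.ratAlgebraicClasses (X ⊗ Z) c) :
    W.extTensor h (W.kunnethComponent hX hZ (2 * n) (2 * q) h z) ∈
      W.ratAlgebraicClasses (X ⊗ Z) c := by
  have hXZ := IsSmoothProjective.tensor_holds hX hZ
  by_cases hq : q ≤ m
  · obtain ⟨a, ha, htr⟩ := W.exists_mem_ratAlgebraicClasses_trace_eq_one hX
    have hpush := W.pushforward_mem_ratAlgebraicClasses hXZ hZ (snd X Z) (a := c) (b := q)
      (d' := 2 * m - 2 * q) (by omega) (by omega) hz
    rw [W.extTensor_kunnethComponent_top_eq hX hZ htr h (j' := 2 * m - 2 * q) (by omega) (by omega) z]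
    exact W.externalCup_mem_ratAlgebraicClasses hX hZ (show n + q = c by omega) h ha hpush
  · haveI := W.subsingleton_obj hZ (i := 2 * q) (by omega)
    rw [Subsingleton.elim (W.kunnethComponent hX hZ (2 * n) (2 * q) h z) 0, map_zero]
    exact zero_mem _

/-- **The `(2c, 0)` Künneth component of a rational algebraic class is rational algebraic**,
unconditionally: `z_{2c,0} = pr_X^* pr_{X*} (z ∪ pr_Z^* b)`, `b ∈ Aᵐ(Z)_ℚ`, `tr_Z b = 1`.
[cite: Kleiman1968AlgebraicCycles, §1.3] [cite: Kahn2020, §6.9 Thm. 6.31 (1) (proof)] -/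
theorem extTensor_kunnethComponent_zero_right_mem_ratAlgebraicClasses (hX : IsSmoothProjective n X)
    (hZ : IsSmoothProjective m Z) {c : ℕ} (h : 2 * c + 0 = 2 * c) {z : W.obj (X ⊗ Z) (2 * c)}
    (hz : z ∈ W.ratAlgebraicClasses (X ⊗ Z) c) :
    W.extTensor h (W.kunnethComponent hX hZ (2 * c) 0 h z) ∈ W.ratAlgebraicClasses (X ⊗ Z) c := by
  have hXZ := IsSmoothProjective.tensor_holds hX hZ
  by_cases hc : c ≤ n
  · obtain ⟨b, hb, htr⟩ := W.exists_mem_ratAlgebraicClasses_trace_eq_one hZ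
    have hb' : W.pullback (snd X Z) (2 * m) b ∈ W.ratAlgebraicClasses (X ⊗ Z) m :=
      W.pullback_ratAlgebraicClasses_le hXZ hZ (snd X Z) m ⟨b, hb, rfl⟩
    have hcup := W.cup_mem_ratAlgebraicClasses hXZ (rfl : c + m = c + m) _ _ hz hb'
    have hpush := W.pushforward_mem_ratAlgebraicClasses hXZ hX (fst X Z) (a := c + m) (b := c)
      (d' := 2 * n - 2 * c) (by omega) (by omega) hcup
    rw [W.extTensor_kunnethComponent_zero_right_eq hX hZ htr (d' := 2 * n - 2 * c)
      (e := 2 * (c + m)) (by omega) (by omega) (by omega) z]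
    exact W.pullback_ratAlgebraicClasses_le hXZ hX (fst X Z) c ⟨_, hpush, rfl⟩
  · haveI := W.subsingleton_obj hX (i := 2 * c) (by omega)
    rw [Subsingleton.elim (W.kunnethComponent hX hZ (2 * c) 0 h z) 0, map_zero]
    exact zero_mem _

/-- **The `(2c - 2m, 2m)` Künneth component of a rational algebraic class is rational algebraic**,
unconditionally: `z_{2p,2m} = pr_{X*} z × b`, `b ∈ Aᵐ(Z)_ℚ`, `tr_Z b = 1`, `pr_{X*} z ∈ A^{c-m}(X)_ℚ`.
Degrees: `2p + 2m = 2c`. [cite: Kleiman1968AlgebraicCycles, §1.3] [cite: Kahn2020, §6.9 Thm. 6.31 (1) (proof)] -/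
theorem extTensor_kunnethComponent_top_right_mem_ratAlgebraicClasses (hX : IsSmoothProjective n X)
    (hZ : IsSmoothProjective m Z) {p c : ℕ} (h : 2 * p + 2 * m = 2 * c) {z : W.obj (X ⊗ Z) (2 * c)}
    (hz : z ∈ W.ratAlgebraicClasses (X ⊗ Z) c) :
    W.extTensor h (W.kunnethComponent hX hZ (2 * p) (2 * m) h z) ∈
      W.ratAlgebraicClasses (X ⊗ Z) c := by
  have hXZ := IsSmoothProjective.tensor_holds hX hZ
  by_cases hp : p ≤ n
  · obtain ⟨b, hb, htr⟩ := W.exists_mem_ratAlgebraicClasses_trace_eq_one hZ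
    have hpush := W.pushforward_mem_ratAlgebraicClasses hXZ hX (fst X Z) (a := c) (b := p)
      (d' := 2 * n - 2 * p) (by omega) (by omega) hz
    rw [W.extTensor_kunnethComponent_top_right_eq hX hZ htr h (i' := 2 * n - 2 * p) (by omega)
      (by omega) z]
    exact W.externalCup_mem_ratAlgebraicClasses hX hZ (show p + m = c by omega) h hpush hb
  · haveI := W.subsingleton_obj hX (i := 2 * p) (by omega)
    rw [Subsingleton.elim (W.kunnethComponent hX hZ (2 * p) (2 * m) h z) 0, map_zero]
    exact zero_mem _

end WeilCohomology

end Literature.AlgebraicGeometry.Motives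

end
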